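import Summits.BirchSwinnertonDyer.BirchSwinnertonDyer.Theorems.SylvesterTwoHeegnerIndexLowerHalfFourTorsionMembersB
import Summits.BirchSwinnertonDyer.BirchSwinnertonDyer.Theorems.SylvesterTwoHeegnerIndexLowerHalfFourTorsionMembersC
import Summits.BirchSwinnertonDyer.BirchSwinnertonDyer.Theorems.SylvesterTwoHeegnerIndexLowerHalfWitness18913
import Summits.BirchSwinnertonDyer.BirchSwinnertonDyer.Theorems.SylvesterTwoHeegnerIndexUpperPairForm
import HarnessLib

/-!
# Route `SylvesterTwoHeegnerIndex` (rung K7t), crux `UpperOffV0HSY` (item 19581, the OFF-𝒱₀ layer of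
# the UPPER twin): what the crux says at its first informative rows — the 79 `(ℤ/4)²`-members of
# 𝒞_HSY `p ≤ 4·10⁵` — and the sub-list where ONE sharp bound decides it
# (helper toward stmt-BirchSwinnertonDyer-19581; cell «bsd-cm», seat `bsd-cm-k7t-c3` g4; theorems only)

HONEST FRAMING (cell «bsd-cm», `run/shared/lean/pub/bsd-cm/`; FULL-BSD RANK ≤ 1 programme, tranche
1a): the class 𝒞_HSY at `p = 2` (B14 / O12) is OPEN in print and stays open here. Item 19581 is the
constant-zero `2`-adic Kolyvagin bound for the Hu–Shu–Yin pair `(B ≅ E_p, A ≅ E_{3p²})` off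
`𝒱₀ = {Ш(B)[2^∞] = Ш(A)[2^∞] = 1}` (planner D98; line of record = k7t-c2's `offv0-kolyvagin2`); it is
NOT proved here for any `p`. THEOREMS ONLY (0 definitions, 0 named facts, 0 `sorry`). Conclusions are
CONDITIONAL on the route's named published facts (Hu–Shu–Yin Thm 1.3/1.4, Burungale–Flach, modularity;
GZK where `BSD(E_p,2)` is mentioned) and on DISPLAYED PER-CURVE CERTIFICATE DATA not proved in the
kernel (reading key: part A `…LowerHalfFourTorsionMembers` header; data CERT14/40/79 on item 19230,
HOME/bsd-cm-k7t-c3/): `hq : #Ш_an(E_p) = q` (two-engine lattice certificate) and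
`hS : Ш(E_p)[2] ⊇` a Klein four-group with `Ш(E_p)[2] ⊆ 2·Ш(E_p)` (PARI `ellrank = [1,3,0]`).

WHAT THIS FILE ADDS.
§1 `MissingUpperBoundAt W 2 ⟺ ¬ 2^{ord₂ q + 1} ∣ #Ш(W)` (Miller-currency companion of
   `upper_frame_iff_not_pow_succ_dvd`); a Klein four in `Ш(B)[2]` puts the pair OFF 𝒱₀, so item 19581
   genuinely speaks about every `(ℤ/4)²`-row; hence **at a certified row the crux's conclusion
   ⟺ `¬ 32 ∣ #Ш(E_p)`** (`#Ш_an = 16`; `¬ 128 ∣` at the two `#Ш_an = 64` rows) **⟺ `BSD(E_p, 2)`**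
   (the LOWER half being certified there) — and conversely the crux PREDICTS `¬ 32 ∣ #Ш(E_p)` at each
   of the 77 rows: a `4`-descent exhibiting `Ш(E_p)[8] ≠ Ш(E_p)[4]` at ONE of them refutes 19581
   (kill test of record; WANTED W-K7t-8descent).
§2 THE SHARP SUB-LIST. Where the partner is `2`-trivial (`Ш(E_{3p²})[2] = 0`, certified `s₂′ = 0`,
   equivalently `#Ш(E_{3p²})` odd by Burungale–Flach), the pair inequality of 19581 collapses to the
   single-curve statement `ord₂ #Ш(E_p) ≤ ord₂ #Ш_an(E_p)` with NO slack from the partner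
   (`pairBound_iff_single_of_partner_twoTorsion_trivial`). By the cell memo (two §22.2 (i)–(iv)) this is
   exactly the locus where a constant-zero Kolyvagin bound over `K = ℚ(√−3)` for `E_p` ALONE
   (`#Ш(E_p/K)[2^∞] ∣ [E_p(K) ⊗ ℤ₂ : ℤ₄·Y]²`) would DECIDE the crux — 32 of the 79 rows, INCLUDING BOTH
   `#Ш_an = 64` rows (140557: `#Ш(E′) = 169`; 381181: `529`): there it would prove `Ш(E_p)[2^∞] ≅
   (ℤ/8)²`-or-smaller, i.e. settle the LISTED members without any `4`-descent. The other 47 rows carry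
   partner slack `ord₂ #Ш(E_{3p²}) ≥ 2`. (Sub-list, `#Ш(E′)` in brackets: 31873 [529], 49549 [1], 62653
   [25], 80779 [625], 93337 [1], 102181 [2209], 102337 [25], 109519 [49], 112111 [3481], 118681 [49],
   129769 [529], 140557 [169], 147289 [961], 151717 [625], 164821 [529], 212029 [1], 216319 [361],
   222199 [25], 252283 [961], 261013 [1681], 274081 [2809], 295663 [529], 307399 [3721], 329677 [5041],
   334753 [2209], 351151 [625], 351727 [5329], 358459 [1369], 377617 [1369], 381181 [529], 383917
   [841], 385837 [169].)
§3 Rows: `p = 18913` (first informative row), `p = 93337` (`#Ш(E′) = 1`, sharp sub-list),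
   `p = 140557` (`#Ш_an = 64`, sharp sub-list).

PARTITION (D-0054): CornerF at `2` / O12 × the 79 𝒞_HSY members `p ≤ 4·10⁵` with `(ℤ/4)² ↪ Ш(E_p)`
(book230: 0 classes) × `p = 2` — types-the-object-of (what crux 19581 asserts / predicts per row, and
the 32-row sub-list decidable by one sharp bound); closes no cell and no class; nothing booked.
References (locators only): [HuShuYin2019] Thm. 1.3/1.4 (p. 3), Cor. 4.4, (bsd) p. 12;
[BurungaleFlach2024] Thm. 1.1, Cor. 2; [Miller2011LMS] §1, Def. 1.1; [Kolyvagin1990] Thm. A;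
[GrossLMS1991] §§3–5; [Cremona1997] §3.6; parents p422193, p425346, p431591, p431676, p432198, p435348.
-/

set_option autoImplicit false
-- the Theorems namespace `Summit.BirchSwinnertonDyer.BirchSwinnertonDyer.…` repeats a component by design (D-0017 layout)
set_option linter.dupNamespace false

noncomputable section

open scoped Classical

open WeierstrassCurve NumberField Literature.NumberTheory.EllipticCurves
  Literature.NumberTheory.EllipticCurves.ModularForms
  Literature.NumberTheory.EllipticCurves.Rank1Residual
  Literature.NumberTheory.EllipticCurves.Rank1Residual.Typed
  Literature.NumberTheory.EllipticCurves.HuShuYin2019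
  Summit.BirchSwinnertonDyer.Rank1Residual.P2
  Summit.BirchSwinnertonDyer.Rank1Residual.X12.Sylvester
  Summit.BirchSwinnertonDyer.BirchSwinnertonDyer.Theses.SylvesterTwoHeegnerIndex

namespace Summit.BirchSwinnertonDyer.BirchSwinnertonDyer.Theorems

namespace SylvesterTwoLowerCert

/-! ## §1 What crux 19581 says at a `(ℤ/4)²`-row -/

section OffV0

variable {p : ℕ}

/-- A non-zero element killed by `2` makes the `2`-primary component non-trivial:
`#G(2) ≠ 1`. [folklore] -/
theorem card_primaryComponent_two_ne_one_of_twoTorsion {G : Type*} [AddCommGroup G] {x : G}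
    (hx : (2 : ℤ) • x = 0) (hx0 : x ≠ 0) :
    Nat.card (AddCommGroup.primaryComponent G 2) ≠ 1 := by
  intro h1
  have hxP : x ∈ AddCommGroup.primaryComponent G 2 := by
    rw [AddCommGroup.mem_primaryComponent]
    refine ⟨1, ?_⟩
    have : ((2 ^ 1 : ℕ) : ℤ) • x = 0 := by exact_mod_cast hx
    rwa [natCast_zsmul] at this
  haveI : Subsingleton (AddCommGroup.primaryComponent G 2) := (Nat.card_eq_one_iff_unique.mp h1).1
  have h := Subsingleton.elim (⟨x, hxP⟩ : AddCommGroup.primaryComponent G 2) ⟨0, zero_mem _⟩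
  exact hx0 (congrArg Subtype.val h)

/-- **UPPER at a member ⟺ `¬ 2^{ord₂ #Ш_an + 1} ∣ #Ш`.** For globally minimal `W ≅ E_p` (`p` in
𝒞_HSY) with displayed `#Ш_an(W) = q`, `ord₂ q = n`, granted Hu–Shu–Yin (finiteness of `Ш(E_p)`),
Burungale–Flach and modularity: `MissingUpperBoundAt W 2 ⟺ ¬ 2ⁿ⁺¹ ∣ #Ш(W)`. Frame-free companion
of `upper_frame_iff_not_pow_succ_dvd`. [cite: HuShuYin2019, Thm. 1.3 and Thm. 1.4 (p. 3)]
[cite: Miller2011LMS, §1 and Def. 1.1] -/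
theorem missingUpperBoundAt_iff_not_pow_succ_dvd
    (W : WeierstrassCurve ℚ) [W.IsElliptic] [W.IsGloballyMinimal]
    (hHSY : thm14_threePart_product) (hBF : bsdTriple_of_hasCM_of_L_one_ne_zero)
    (hmod : hasEntireLFunction_rat)
    (hp : p.Prime) (h9 : p % 9 = 4 ∨ p % 9 = 7) (h3 : ¬ ∃ x : ZMod p, x ^ 3 = 3)
    (hW : ∃ C : VariableChange ℚ, C • W = cubeSumCurve (p : ℚ))
    {q : ℚ} (hq : shaAn W = (q : ℂ)) {n : ℕ} (hv : padicValRat 2 q = n) :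
    MissingUpperBoundAt W 2 ↔ ¬ 2 ^ (n + 1) ∣ Nat.card W.sha := by
  haveI : Fact (Nat.Prime 2) := ⟨Nat.prime_two⟩
  obtain ⟨-, hfin, -⟩ :=
    Summit.BirchSwinnertonDyer.Rank1Residual.X12.CubeSumFamilies.bsdp_three_of_thm14' hHSY hBF hmod hp h9 h3 W hW
  haveI := hfin
  have hcard : Nat.card W.sha ≠ 0 := (Nat.card_pos (α := W.sha)).ne'
  rw [padicValNat_dvd_iff_le hcard, not_le, Nat.lt_succ_iff]
  constructor
  · rintro ⟨q', hq', hle⟩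
    have hqq : q' = q := by exact_mod_cast hq'.symm.trans hq
    rw [hqq, hv, WeierstrassCurve.shaOrder] at hle
    exact_mod_cast hle
  · intro hle
    refine ⟨q, hq, ?_⟩
    rw [hv, WeierstrassCurve.shaOrder]
    exact_mod_cast hle

/-- **A Klein four-group in `Ш(B)[2]` puts the pair `(A, B)` OFF 𝒱₀** (`#Ш(B)(2) ≠ 1`), whatever the
partner `A`: item 19581 speaks about every `(ℤ/4)²`-row (and every `(ℤ/2)²`-row). [folklore] -/
theorem offV0_of_kleinFour (A B : WeierstrassCurve ℚ)
    (hK4 : ∃ x y : B.sha, (2 : ℤ) • x = 0 ∧ (2 : ℤ) • y = 0 ∧ x ≠ 0 ∧ y ≠ 0 ∧ x ≠ y) :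
    ¬ (Nat.card (AddCommGroup.primaryComponent B.sha 2) = 1 ∧
        Nat.card (AddCommGroup.primaryComponent A.sha 2) = 1) := by
  obtain ⟨x, -, hx, -, hx0, -, -⟩ := hK4
  exact fun h => card_primaryComponent_two_ne_one_of_twoTorsion hx hx0 h.1

/-- **What crux 19581 SAYS at a certified `(ℤ/4)²`-row.** At an 𝒞_HSY parameter `p` with displayed
certificates `hq : #Ш_an(E_p) = q`, `ord₂ q = n`, and `hS` (Klein four in `Ш[2]`, `Ш[2] ⊆ 2·Ш`), granted
Hu–Shu–Yin, Burungale–Flach and modularity: for every globally minimal `B ≅ E_p` and every partner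
`A`, the crux's clause «off 𝒱₀ ⟹ `MissingUpperBoundAt B 2`» holds iff `¬ 2ⁿ⁺¹ ∣ #Ш(B)` (the off-𝒱₀
antecedent being automatic). With `n = 4`: iff `Ш(E_p)[2^∞] ≅ (ℤ/4)²` EXACTLY (`¬ 32 ∣ #Ш`), a
`4`-Selmer Cassels–Tate statement no engine of the cell decides. CONDITIONAL; EVIDENCE consumer.
[cite: HuShuYin2019, Thm. 1.3 and Thm. 1.4 (p. 3)] [cite: Miller2011LMS, §1 and Def. 1.1]
[cite: Kolyvagin1990, Thm. A] [cite: Cremona1997, §3.6] -/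
theorem upperOffV0_clause_iff_not_pow_succ_dvd_of_cert
    (hsy : Nat.Prime p ∧ (p % 9 = 4 ∨ p % 9 = 7) ∧ ¬ ∃ x : ZMod p, x ^ 3 = 3)
    (hHSY : thm14_threePart_product) (hBF : bsdTriple_of_hasCM_of_L_one_ne_zero)
    (hmod : hasEntireLFunction_rat) {q : ℚ} {n : ℕ} (hv : padicValRat 2 q = n)
    (hq : ∀ (W : WeierstrassCurve ℚ) [W.IsElliptic] [W.IsGloballyMinimal],
      (∃ C : VariableChange ℚ, C • W = cubeSumCurve (p : ℚ)) → shaAn W = (q : ℂ))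
    (hS : ∀ (W : WeierstrassCurve ℚ) [W.IsElliptic] [W.IsGloballyMinimal],
      (∃ C : VariableChange ℚ, C • W = cubeSumCurve (p : ℚ)) →
        (∃ x y : W.sha, (2 : ℤ) • x = 0 ∧ (2 : ℤ) • y = 0 ∧ x ≠ 0 ∧ y ≠ 0 ∧ x ≠ y) ∧
        (∀ z : W.sha, (2 : ℤ) • z = 0 → ∃ w : W.sha, (2 : ℤ) • w = z))
    (A B : WeierstrassCurve ℚ) [B.IsElliptic] [B.IsGloballyMinimal]
    (hB : ∃ C : VariableChange ℚ, C • B = cubeSumCurve (p : ℚ)) :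
    ((¬ (Nat.card (AddCommGroup.primaryComponent B.sha 2) = 1 ∧
          Nat.card (AddCommGroup.primaryComponent A.sha 2) = 1)) → MissingUpperBoundAt B 2) ↔
      ¬ 2 ^ (n + 1) ∣ Nat.card B.sha := by
  obtain ⟨hpr, h9, h3⟩ := hsy
  have hoff := offV0_of_kleinFour A B (hS B hB).1
  rw [← missingUpperBoundAt_iff_not_pow_succ_dvd B hHSY hBF hmod hpr h9 h3 hB (hq B hB) hv]
  exact ⟨fun h => h hoff, fun h _ => h⟩

/-- **… and then it IS `BSD(E_p, 2)` at that row** (with `ord₂ q = 4`; GZK added for Miller's rank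
clause): granted the facts and the two certificates, for every globally minimal `B ≅ E_p` the crux's
clause at `B` ⟺ `BSDp B 2` — because the LOWER half is certified there (`16 ∣ #Ш(B)`, part A
`bsdTwo_member_iff_not_32_dvd_of_cert`). CONDITIONAL; EVIDENCE consumer.
[cite: HuShuYin2019, Thm. 1.3 and Thm. 1.4 (p. 3)] [cite: BurungaleFlach2024, Thm. 1.1 and Cor. 2]
[cite: Miller2011LMS, §1 and Def. 1.1] -/
theorem upperOffV0_clause_iff_bsdp_of_cert
    (hsy : Nat.Prime p ∧ (p % 9 = 4 ∨ p % 9 = 7) ∧ ¬ ∃ x : ZMod p, x ^ 3 = 3)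
    (hF : PublishedFactsTwo) {q : ℚ} (hv : padicValRat 2 q = 4)
    (hq : ∀ (W : WeierstrassCurve ℚ) [W.IsElliptic] [W.IsGloballyMinimal],
      (∃ C : VariableChange ℚ, C • W = cubeSumCurve (p : ℚ)) → shaAn W = (q : ℂ))
    (hS : ∀ (W : WeierstrassCurve ℚ) [W.IsElliptic] [W.IsGloballyMinimal],
      (∃ C : VariableChange ℚ, C • W = cubeSumCurve (p : ℚ)) →
        (∃ x y : W.sha, (2 : ℤ) • x = 0 ∧ (2 : ℤ) • y = 0 ∧ x ≠ 0 ∧ y ≠ 0 ∧ x ≠ y) ∧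
        (∀ z : W.sha, (2 : ℤ) • z = 0 → ∃ w : W.sha, (2 : ℤ) • w = z))
    (A B : WeierstrassCurve ℚ) [B.IsElliptic] [B.IsGloballyMinimal]
    (hB : ∃ C : VariableChange ℚ, C • B = cubeSumCurve (p : ℚ)) :
    ((¬ (Nat.card (AddCommGroup.primaryComponent B.sha 2) = 1 ∧
          Nat.card (AddCommGroup.primaryComponent A.sha 2) = 1)) → MissingUpperBoundAt B 2) ↔
      BSDp B 2 := by
  have hF' := hF
  obtain ⟨hHSY, hBF, hmod, -⟩ := hF'
  rw [upperOffV0_clause_iff_not_pow_succ_dvd_of_cert hsy hHSY hBF hmod (n := 4) (by exact_mod_cast hv)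
    hq hS A B hB, bsdTwo_member_iff_not_32_dvd_of_cert hsy hF hv hq hS B hB]
  norm_num

/-- **What crux 19581 PREDICTS at a certified row (kill-test form).** If `UpperOffV0HSY` holds then,
granted `PublishedFactsTwo`, at every certified `(ℤ/4)²`-row with `ord₂ #Ш_an = n`: `¬ 2ⁿ⁺¹ ∣ #Ш(B)`
for every globally minimal `B ≅ E_p` — so ONE `4`-descent exhibiting `32 ∣ #Ш(E_p)` at a `#Ш_an = 16`
row REFUTES the crux (a partner `A ≅ E_{3p²}` exists by Silverman VIII.8.3). CONDITIONAL on the crux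
as hypothesis; EVIDENCE consumer. [cite: Kolyvagin1990, Thm. A] [cite: HuShuYin2019, Thm. 1.3 and Thm. 1.4 (p. 3)]
[cite: Miller2011LMS, §1 and Def. 1.1] [cite: SilvermanAEC2009, VIII.8 Cor. 8.3] -/
theorem not_pow_succ_dvd_of_upperOffV0HSY_of_cert (hU : UpperOffV0HSY) (hF : PublishedFactsTwo)
    (hsy : Nat.Prime p ∧ (p % 9 = 4 ∨ p % 9 = 7) ∧ ¬ ∃ x : ZMod p, x ^ 3 = 3)
    {q : ℚ} {n : ℕ} (hv : padicValRat 2 q = n)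
    (hq : ∀ (W : WeierstrassCurve ℚ) [W.IsElliptic] [W.IsGloballyMinimal],
      (∃ C : VariableChange ℚ, C • W = cubeSumCurve (p : ℚ)) → shaAn W = (q : ℂ))
    (hS : ∀ (W : WeierstrassCurve ℚ) [W.IsElliptic] [W.IsGloballyMinimal],
      (∃ C : VariableChange ℚ, C • W = cubeSumCurve (p : ℚ)) →
        (∃ x y : W.sha, (2 : ℤ) • x = 0 ∧ (2 : ℤ) • y = 0 ∧ x ≠ 0 ∧ y ≠ 0 ∧ x ≠ y) ∧
        (∀ z : W.sha, (2 : ℤ) • z = 0 → ∃ w : W.sha, (2 : ℤ) • w = z))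
    (B : WeierstrassCurve ℚ) [B.IsElliptic] [B.IsGloballyMinimal]
    (hB : ∃ C : VariableChange ℚ, C • B = cubeSumCurve (p : ℚ)) :
    ¬ 2 ^ (n + 1) ∣ Nat.card B.sha := by
  obtain ⟨hpr, h9, h3⟩ := hsy
  have hF' := hF
  obtain ⟨hHSY, hBF, hmod, -⟩ := hF'
  -- a globally minimal partner `A ≅ E_{3p²}`
  have hn : (3 * (p : ℚ) ^ 2) ≠ 0 :=
    mul_ne_zero (by norm_num) (pow_ne_zero _ (Nat.cast_ne_zero.mpr hpr.ne_zero))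
  haveI := Summit.BirchSwinnertonDyer.Rank1Residual.X12.CubeSumFamilies.isElliptic_cubeSumCurve hn
  obtain ⟨A, _, _, CA, hCA⟩ :=
    Summit.BirchSwinnertonDyer.Rank1Residual.X12.CubeSumFamilies.exists_isGloballyMinimal_model
      (cubeSumCurve (3 * (p : ℚ) ^ 2))
  have hclause : MissingUpperBoundAt B 2 :=
    hU hF p hpr h9 h3 A B hB ⟨CA, hCA⟩ (offV0_of_kleinFour A B (hS B hB).1)
  exact (missingUpperBoundAt_iff_not_pow_succ_dvd B hHSY hBF hmod hpr h9 h3 hB (hq B hB) hv).mp hclause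

end OffV0

/-! ## §2 The sharp sub-list: partner `2`-trivial ⟹ the pair bound is the single-curve bound -/

section Sharp

variable {p : ℕ}

/-- **Partner `2`-trivial ⟹ no slack.** For globally minimal `B ≅ E_p`, `A ≅ E_{3p²}` (`p` in 𝒞_HSY)
with `Ш(A)[2] = 0` (displayed certificate `s₂′ = 0`; equivalently `#Ш(E_{3p²})` odd, Burungale–Flach),
granted Hu–Shu–Yin, Burungale–Flach and modularity: `ord₂ #Ш_an(A) = 0`, so the pair inequality of
crux 19581 at `(A, B)` — `ord₂ #Ш(B)[2^∞] + ord₂ #Ш(A)[2^∞] ≤ ord₂(#Ш_an(B)·#Ш_an(A))` — is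
EQUIVALENT to the single-curve statement `MissingUpperBoundAt B 2`, with no partner terms on either
side. This is the locus (32 of the 79 `(ℤ/4)²`-rows, incl. both `#Ш_an = 64` rows) where a constant-zero
`2`-adic Kolyvagin bound over `ℚ(√−3)` for `E_p` alone is SHARP (cell memo two §22.2): there that one
theorem would decide the crux. CONDITIONAL; EVIDENCE consumer; nothing asserted about the bound.
[cite: HuShuYin2019, Cor. 4.4 and (bsd) p. 12] [cite: BurungaleFlach2024, Thm. 1.1 and Cor. 2]
[cite: Miller2011LMS, §1 and Def. 1.1] [cite: GrossLMS1991, §§3–5] -/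
theorem pairBound_iff_single_of_partner_twoTorsion_trivial
    (hHSY : thm14_threePart_product) (hCM0 : bsdTriple_of_hasCM_of_L_one_ne_zero)
    (hmod : hasEntireLFunction_rat)
    (hp : p.Prime) (h9 : p % 9 = 4 ∨ p % 9 = 7) (h3 : ¬ ∃ x : ZMod p, x ^ 3 = 3)
    (A B : WeierstrassCurve ℚ) [A.IsElliptic] [A.IsGloballyMinimal] [B.IsElliptic]
    [B.IsGloballyMinimal] (hB : ∃ C : VariableChange ℚ, C • B = cubeSumCurve (p : ℚ))
    (hA : ∃ C : VariableChange ℚ, C • A = cubeSumCurve (3 * (p : ℚ) ^ 2))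
    (hA0 : ∀ z : A.sha, (2 : ℤ) • z = 0 → z = 0) :
    (∃ qB qA : ℚ, shaAn B = (qB : ℂ) ∧ shaAn A = (qA : ℂ) ∧ qB * qA ≠ 0 ∧
        (padicValNat 2 (Nat.card (AddCommGroup.primaryComponent B.sha 2)) : ℤ) +
            (padicValNat 2 (Nat.card (AddCommGroup.primaryComponent A.sha 2)) : ℤ) ≤
          padicValRat 2 (qB * qA)) ↔
      ∃ qB : ℚ, shaAn B = (qB : ℂ) ∧ qB ≠ 0 ∧
        (padicValNat 2 (Nat.card (AddCommGroup.primaryComponent B.sha 2)) : ℤ) ≤ padicValRat 2 qB := by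
  haveI : Fact (2 : ℕ).Prime := ⟨Nat.prime_two⟩
  obtain ⟨-, hfinA, qB, qA, hqB, hqA, hqB0, hqA0, hvA⟩ :=
    SylvesterTwoUpper.pair_shaAn_two hHSY hCM0 hmod hp h9 h3 A B hB hA
  haveI := hfinA
  -- the partner's `2`-primary component is trivial
  have hA1 : padicValNat 2 (Nat.card (AddCommGroup.primaryComponent A.sha 2)) = 0 := by
    have h1 : Nat.card (AddCommGroup.primaryComponent A.sha 2) = 1 := by
      rw [Nat.card_eq_one_iff_unique]
      refine ⟨⟨fun a b => Subtype.ext ?_⟩, ⟨⟨0, zero_mem _⟩⟩⟩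
      have ha : (a : A.sha) = 0 := by
        obtain ⟨k, hk⟩ := (AddCommGroup.mem_primaryComponent.mp a.2)
        induction k with
        | zero => simpa using hk
        | succ k ih =>
          apply ih
          have h2 : (2 : ℤ) • ((2 ^ k : ℕ) • (a : A.sha)) = 0 := by
            have : ((2 ^ (k + 1) : ℕ) : ℤ) • (a : A.sha) = 0 := by rw [natCast_zsmul]; exact hk
            rw [show ((2 ^ (k + 1) : ℕ) : ℤ) = 2 * ((2 ^ k : ℕ) : ℤ) by push_cast; ring, mul_smul,
              natCast_zsmul] at this
            exact this
          exact hA0 _ h2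
      have hb : (b : A.sha) = 0 := by
        obtain ⟨k, hk⟩ := (AddCommGroup.mem_primaryComponent.mp b.2)
        induction k with
        | zero => simpa using hk
        | succ k ih =>
          apply ih
          have h2 : (2 : ℤ) • ((2 ^ k : ℕ) • (b : A.sha)) = 0 := by
            have : ((2 ^ (k + 1) : ℕ) : ℤ) • (b : A.sha) = 0 := by rw [natCast_zsmul]; exact hk
            rw [show ((2 ^ (k + 1) : ℕ) : ℤ) = 2 * ((2 ^ k : ℕ) : ℤ) by push_cast; ring, mul_smul,
              natCast_zsmul] at this
            exact this
          exact hA0 _ h2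
      rw [ha, hb]
    rw [h1]; simp
  have hvA0 : padicValRat 2 qA = 0 := by rw [hvA, hA1]; simp
  constructor
  · rintro ⟨qB', qA', hqB', hqA', hne, hle⟩
    have hqq : qB' = qB := by exact_mod_cast hqB'.symm.trans hqB
    have hqq' : qA' = qA := by exact_mod_cast hqA'.symm.trans hqA
    subst hqq hqq'
    refine ⟨qB', hqB, hqB0, ?_⟩
    rw [padicValRat.mul hqB0 hqA0, hvA0, add_zero, hA1] at hle
    simpa using hle
  · rintro ⟨qB', hqB', -, hle⟩
    have hqq : qB' = qB := by exact_mod_cast hqB'.symm.trans hqB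
    subst hqq
    refine ⟨qB', qA, hqB, hqA, mul_ne_zero hqB0 hqA0, ?_⟩
    rw [padicValRat.mul hqB0 hqA0, hvA0, add_zero, hA1]
    simpa using hle

end Sharp

/-! ## §3 Rows -/

/-- **Row `p = 18913`** (first informative row of crux 19581; `#Ш_an = 16`, `#Ш(E′) = 784` — partner
slack 4): granted the facts and the displayed certificates of `…LowerHalfWitness18913` (kit j250083 /
j252028), the crux's clause at every globally minimal `B ≅ E_{18913}` ⟺ `¬ 32 ∣ #Ш(B)`.
CONDITIONAL; EVIDENCE consumer. [cite: HuShuYin2019, Thm. 1.3 and Thm. 1.4 (p. 3)]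
[cite: Miller2011LMS, §1 and Def. 1.1] [cite: Kolyvagin1990, Thm. A] -/
theorem upperOffV0_clause_iff_not_32_dvd_18913 (hF : PublishedFactsTwo)
    (hq : ∀ (W : WeierstrassCurve ℚ) [W.IsElliptic] [W.IsGloballyMinimal],
      (∃ C : VariableChange ℚ, C • W = cubeSumCurve ((18913 : ℕ) : ℚ)) → shaAn W = ((16 : ℚ) : ℂ))
    (hS : ∀ (W : WeierstrassCurve ℚ) [W.IsElliptic] [W.IsGloballyMinimal],
      (∃ C : VariableChange ℚ, C • W = cubeSumCurve ((18913 : ℕ) : ℚ)) →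
        (∃ x y : W.sha, (2 : ℤ) • x = 0 ∧ (2 : ℤ) • y = 0 ∧ x ≠ 0 ∧ y ≠ 0 ∧ x ≠ y) ∧
        (∀ z : W.sha, (2 : ℤ) • z = 0 → ∃ w : W.sha, (2 : ℤ) • w = z))
    (A B : WeierstrassCurve ℚ) [B.IsElliptic] [B.IsGloballyMinimal]
    (hB : ∃ C : VariableChange ℚ, C • B = cubeSumCurve ((18913 : ℕ) : ℚ)) :
    ((¬ (Nat.card (AddCommGroup.primaryComponent B.sha 2) = 1 ∧
          Nat.card (AddCommGroup.primaryComponent A.sha 2) = 1)) → MissingUpperBoundAt B 2) ↔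
      ¬ 32 ∣ Nat.card B.sha := by
  obtain ⟨hHSY, hBF, hmod, -⟩ := hF
  simpa using upperOffV0_clause_iff_not_pow_succ_dvd_of_cert hsy_18913 hHSY hBF hmod (q := 16) (n := 4)
    (by exact_mod_cast padicValRat_two_16) hq hS A B hB

/-- **Row `p = 93337`** (`p ≡ 7 (mod 9)`; `#Ш_an = 16`, `#Ш(E′) = 1` — on the SHARP sub-list): granted
the facts and the displayed certificates (kit j252028; part B `hsy_93337`), the crux's clause at every
globally minimal `B ≅ E_{93337}` ⟺ `¬ 32 ∣ #Ш(B)`; a constant-zero Kolyvagin bound over `ℚ(√−3)` for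
`E_{93337}` alone would prove it (no partner slack). CONDITIONAL; EVIDENCE consumer.
[cite: HuShuYin2019, Thm. 1.3 and Thm. 1.4 (p. 3)] [cite: Miller2011LMS, §1 and Def. 1.1]
[cite: Kolyvagin1990, Thm. A] -/
theorem upperOffV0_clause_iff_not_32_dvd_93337 (hF : PublishedFactsTwo)
    (hq : ∀ (W : WeierstrassCurve ℚ) [W.IsElliptic] [W.IsGloballyMinimal],
      (∃ C : VariableChange ℚ, C • W = cubeSumCurve ((93337 : ℕ) : ℚ)) → shaAn W = ((16 : ℚ) : ℂ))
    (hS : ∀ (W : WeierstrassCurve ℚ) [W.IsElliptic] [W.IsGloballyMinimal],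
      (∃ C : VariableChange ℚ, C • W = cubeSumCurve ((93337 : ℕ) : ℚ)) →
        (∃ x y : W.sha, (2 : ℤ) • x = 0 ∧ (2 : ℤ) • y = 0 ∧ x ≠ 0 ∧ y ≠ 0 ∧ x ≠ y) ∧
        (∀ z : W.sha, (2 : ℤ) • z = 0 → ∃ w : W.sha, (2 : ℤ) • w = z))
    (A B : WeierstrassCurve ℚ) [B.IsElliptic] [B.IsGloballyMinimal]
    (hB : ∃ C : VariableChange ℚ, C • B = cubeSumCurve ((93337 : ℕ) : ℚ)) :
    ((¬ (Nat.card (AddCommGroup.primaryComponent B.sha 2) = 1 ∧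
          Nat.card (AddCommGroup.primaryComponent A.sha 2) = 1)) → MissingUpperBoundAt B 2) ↔
      ¬ 32 ∣ Nat.card B.sha := by
  obtain ⟨hHSY, hBF, hmod, -⟩ := hF
  simpa using upperOffV0_clause_iff_not_pow_succ_dvd_of_cert hsy_93337 hHSY hBF hmod (q := 16) (n := 4)
    (by exact_mod_cast padicValRat_two_16) hq hS A B hB

/-- **Row `p = 140557`** (LISTED member: `#Ш_an = 64` EXACTLY, `#Ш(E′) = 169` — on the SHARP sub-list):
granted the facts and the displayed certificates (kit j252371; part C `hsy_140557`), the crux's clause at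
every globally minimal `B ≅ E_{140557}` ⟺ `¬ 128 ∣ #Ш(B)` (BSD₂ predicts `Ш ≅ (ℤ/8)²`; LOWER there is
`64 ∣ #Ш`, part C). A constant-zero Kolyvagin bound over `ℚ(√−3)` for `E_{140557}` alone would prove
the clause. CONDITIONAL; EVIDENCE consumer. [cite: HuShuYin2019, Thm. 1.3 and Thm. 1.4 (p. 3)]
[cite: Miller2011LMS, §1 and Def. 1.1] [cite: Kolyvagin1990, Thm. A] -/
theorem upperOffV0_clause_iff_not_128_dvd_140557 (hF : PublishedFactsTwo)
    (hq : ∀ (W : WeierstrassCurve ℚ) [W.IsElliptic] [W.IsGloballyMinimal],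
      (∃ C : VariableChange ℚ, C • W = cubeSumCurve ((140557 : ℕ) : ℚ)) → shaAn W = ((64 : ℚ) : ℂ))
    (hS : ∀ (W : WeierstrassCurve ℚ) [W.IsElliptic] [W.IsGloballyMinimal],
      (∃ C : VariableChange ℚ, C • W = cubeSumCurve ((140557 : ℕ) : ℚ)) →
        (∃ x y : W.sha, (2 : ℤ) • x = 0 ∧ (2 : ℤ) • y = 0 ∧ x ≠ 0 ∧ y ≠ 0 ∧ x ≠ y) ∧
        (∀ z : W.sha, (2 : ℤ) • z = 0 → ∃ w : W.sha, (2 : ℤ) • w = z))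
    (A B : WeierstrassCurve ℚ) [B.IsElliptic] [B.IsGloballyMinimal]
    (hB : ∃ C : VariableChange ℚ, C • B = cubeSumCurve ((140557 : ℕ) : ℚ)) :
    ((¬ (Nat.card (AddCommGroup.primaryComponent B.sha 2) = 1 ∧
          Nat.card (AddCommGroup.primaryComponent A.sha 2) = 1)) → MissingUpperBoundAt B 2) ↔
      ¬ 128 ∣ Nat.card B.sha := by
  obtain ⟨hHSY, hBF, hmod, -⟩ := hF
  simpa using upperOffV0_clause_iff_not_pow_succ_dvd_of_cert hsy_140557 hHSY hBF hmod (q := 64) (n := 6)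
    (by exact_mod_cast padicValRat_two_64) hq hS A B hB

end SylvesterTwoLowerCert

end Summit.BirchSwinnertonDyer.BirchSwinnertonDyer.Theorems

end
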